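import Summits.CriticalPhenomena.PercolationContinuityZ3.Theorems.SahiMasterFamilyFiveStep

/-!
# Shrunk frames at order four, II: one member shrunk by a pairwise annihilator

Unit `prim-master-conj` (crux anchor stmt-CriticalPhenomena-4575); companion of `SahiMasterFamilyShrunkFrames.lean`.  The second
order-four family produced by peeling the order-five step (K4-NOTES §11 of the unit, case (a)): `(D, K, X', Y)` with `(K_D, K, Y)` an
independent frame, `X'` arbitrary, and `D = K_D ∖ N_D` where `N_D` kills the pairwise products of `K, X', Y`.  PROVED:
* `sahiE_four_of_pairwise_annihilator` (any weight, NO vanishing hypotheses): if `h` kills `kx`, `ky`, `xy` then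
  `E_4(h,k,x,y) = −E(kh)E_2(x,y) − E(xh)E_2(k,y) − E(yh)E_2(k,x) − E(h)E_3(k,x,y)`;
* `sahiE_four_eq_of_pairwise_shrink`: `d = k_d − n_d` ⇒
  `E_4(d,k,x,y) = E_4(k_d,k,x,y) + E(kn_d)E_2(x,y) + E(xn_d)E_2(k,y) + E(yn_d)E_2(k,x) + E(n_d)E_3(k,x,y)`;
* `sahiE_four_ind_nonneg_of_pairwise_shrink`: for increasing `K_D, K, Y` with pairwise disjoint essential supports, `X'` increasing,
  and any `D ⊆ K_D` with `X' ∩ Y ∩ K_D ⊆ D`, `X' ∩ K ∩ K_D ⊆ D`, `Y ∩ K ∩ K_D ⊆ D`: **`E_4(μ_p; 1_D, 1_K, 1_{X'}, 1_Y) ≥ 0`**.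
Everything proved; axioms standard. [this work]
-/

noncomputable section

open scoped Classical

namespace Summit.CriticalPhenomena.PercolationContinuityZ3.Theorems

open Finset Function
open Literature.Combinatorics.Sahi2008
open Literature.Probability.Percolation (DeterminedBy)
open Literature.Probability.Percolation.DecisionTree (ind ind_of_mem ind_of_not_mem ind_nonneg)

section Abstract

variable {α : Type*} [Fintype α]

/-- **Pairwise annihilator at order four** (any weight): if `h` kills `k·x`, `k·y`, `x·y` then
`E_4(h,k,x,y) = −E(kh)E_2(x,y) − E(xh)E_2(k,y) − E(yh)E_2(k,x) − E(h)E_3(k,x,y)`. [this work] -/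
theorem sahiE_four_of_pairwise_annihilator (μ : α → ℝ) (h k x y : α → ℝ) (hkx : k * x * h = 0) (hky : k * y * h = 0)
    (hxy : x * y * h = 0) :
    sahiE μ 4 ![h, k, x, y] = -(ex μ (k * h) * sahiE μ 2 ![x, y]) - ex μ (x * h) * sahiE μ 2 ![k, y]
      - ex μ (y * h) * sahiE μ 2 ![k, x] - ex μ h * sahiE μ 3 ![k, x, y] := by
  have hcons : (![h, k, x, y] : Fin 4 → α → ℝ) = Fin.cons h ![k, x, y] := by funext j; fin_cases j <;> rfl
  rw [hcons, sahiE_fin_cons, Fin.sum_univ_three]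
  simp only [Matrix.cons_val_zero, Matrix.cons_val_one, Matrix.cons_val]
  have t0 : sahiE μ 3 (update ![k, x, y] 0 (k * h)) = -(sahiE μ 2 ![x, y] * ex μ (k * h)) := by
    have e : update (![k, x, y] : Fin 3 → α → ℝ) 0 (k * h) = Fin.cons (k * h) ![x, y] := by funext j; fin_cases j <;> rfl
    have hann : ∀ j : Fin 2, (![x, y] : Fin 2 → α → ℝ) j * (k * h) = 0 := by
      intro j; fin_cases j
      · show x * (k * h) = 0; rw [mul_left_comm, ← mul_assoc]; exact hkx
      · show y * (k * h) = 0; rw [mul_left_comm, ← mul_assoc]; exact hky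
    rw [e, SahiMeetTowerAll.sahiE_cons_of_mul_eq_zero μ 1 _ _ hann]
  have t1 : sahiE μ 3 (update ![k, x, y] 1 (x * h)) = -(sahiE μ 2 ![k, y] * ex μ (x * h)) := by
    have e : sahiE μ 3 (update ![k, x, y] 1 (x * h)) = sahiE μ 3 (Fin.cons (x * h) ![k, y] : Fin 3 → α → ℝ) := by
      have : update (![k, x, y] : Fin 3 → α → ℝ) 1 (x * h) = ![k, x * h, y] := by funext j; fin_cases j <;> rfl
      rw [this, sahiE_eq_cons_succAbove μ 1 _ 1]
      congr 1; funext j; fin_cases j <;> rfl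
    have hann : ∀ j : Fin 2, (![k, y] : Fin 2 → α → ℝ) j * (x * h) = 0 := by
      intro j; fin_cases j
      · show k * (x * h) = 0; rw [← mul_assoc]; exact hkx
      · show y * (x * h) = 0; rw [mul_left_comm, ← mul_assoc]; exact hxy
    rw [e, SahiMeetTowerAll.sahiE_cons_of_mul_eq_zero μ 1 _ _ hann]
  have t2 : sahiE μ 3 (update ![k, x, y] 2 (y * h)) = -(sahiE μ 2 ![k, x] * ex μ (y * h)) := by
    have e : sahiE μ 3 (update ![k, x, y] 2 (y * h)) = sahiE μ 3 (Fin.cons (y * h) ![k, x] : Fin 3 → α → ℝ) := by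
      have : update (![k, x, y] : Fin 3 → α → ℝ) 2 (y * h) = ![k, x, y * h] := by funext j; fin_cases j <;> rfl
      rw [this, sahiE_eq_cons_succAbove μ 1 _ 2]
      congr 1; funext j; fin_cases j <;> rfl
    have hann : ∀ j : Fin 2, (![k, x] : Fin 2 → α → ℝ) j * (y * h) = 0 := by
      intro j; fin_cases j
      · show k * (y * h) = 0; rw [← mul_assoc]; exact hky
      · show x * (y * h) = 0; rw [← mul_assoc]; exact hxy
    rw [e, SahiMeetTowerAll.sahiE_cons_of_mul_eq_zero μ 1 _ _ hann]
  rw [t0, t1, t2]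
  ring

/-- **One pairwise-shrunk slot at order four, any weight**: `d = k_d − n_d`, `n_d` killing `kx, ky, xy` ⇒
`E_4(d,k,x,y) = E_4(k_d,k,x,y) + E(kn_d)E_2(x,y) + E(xn_d)E_2(k,y) + E(yn_d)E_2(k,x) + E(n_d)E_3(k,x,y)`. [this work] -/
theorem sahiE_four_eq_of_pairwise_shrink (μ : α → ℝ) (d k x y kd nd : α → ℝ) (hd : d = kd - nd)
    (hkx : k * x * nd = 0) (hky : k * y * nd = 0) (hxy : x * y * nd = 0) :
    sahiE μ 4 ![d, k, x, y] = sahiE μ 4 ![kd, k, x, y] + ex μ (k * nd) * sahiE μ 2 ![x, y]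
      + ex μ (x * nd) * sahiE μ 2 ![k, y] + ex μ (y * nd) * sahiE μ 2 ![k, x] + ex μ nd * sahiE μ 3 ![k, x, y] := by
  have u0 : ∀ f : α → ℝ, (![f, k, x, y] : Fin 4 → α → ℝ) = update ![d, k, x, y] 0 f := fun f => by
    funext j; fin_cases j <;> rfl
  have key := sahiE_update_lin μ 4 (![d, k, x, y]) 0 1 (-1) kd nd
  rw [← u0, ← u0, ← u0, show (1 : ℝ) • kd + (-1 : ℝ) • nd = d by rw [hd, one_smul, neg_one_smul]; abel] at key
  rw [key, sahiE_four_of_pairwise_annihilator μ nd k x y hkx hky hxy]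
  ring

end Abstract

section Events

variable {ι : Type} [Fintype ι]

/-- `Cov ≥ 0` in vector form (Harris). [folklore] -/
theorem sahiE_two_vec_nonneg (p : ι → unitInterval) {A B : Set (Set ι)} (hA : IsUpperSet A) (hB : IsUpperSet B) :
    0 ≤ sahiE (bernoulliWeight p) 2 ![ind A, ind B] := by
  have h := masterFamilyNonneg_of_le_two le_rfl ι p ![A, B] (by
    intro j; fin_cases j
    · exact hA
    · exact hB)
  have e : (fun j => ind ((![A, B] : Fin 2 → Set (Set ι)) j)) = ![ind A, ind B] := by
    funext j; fin_cases j <;> rfl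
  rwa [e] at h

/-- **`E_4 ≥ 0` for a frame with one member shrunk by a pairwise annihilator and one arbitrary event.**  Let `K_D, K, Y`
be increasing events with pairwise disjoint essential supports, `X'` any increasing event, and `D ⊆ K_D` any event with
`X' ∩ Y ∩ K_D ⊆ D`, `X' ∩ K ∩ K_D ⊆ D`, `Y ∩ K ∩ K_D ⊆ D`.  Then `0 ≤ E_4(μ_p; 1_D, 1_K, 1_{X'}, 1_Y)` for every `p ∈ [0,1]^ι`.
[this work] -/
theorem sahiE_four_ind_nonneg_of_pairwise_shrink (p : ι → unitInterval) {D KD K X' Y : Set (Set ι)} (hKD : IsUpperSet KD)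
    (hK : IsUpperSet K) (hX : IsUpperSet X') (hY : IsUpperSet Y) (dKDK : Disjoint (esupp KD) (esupp K))
    (dKDY : Disjoint (esupp KD) (esupp Y)) (dKY : Disjoint (esupp K) (esupp Y)) (hDKD : D ⊆ KD)
    (hXY : X' ∩ Y ∩ KD ⊆ D) (hXK : X' ∩ K ∩ KD ⊆ D) (hYK : Y ∩ K ∩ KD ⊆ D) :
    0 ≤ sahiE (bernoulliWeight p) 4 ![ind D, ind K, ind X', ind Y] := by
  have aXY := ind_mul_ind_mul_ind_diff_eq_zero hXY
  have aXK := ind_mul_ind_mul_ind_diff_eq_zero hXK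
  have aYK := ind_mul_ind_mul_ind_diff_eq_zero hYK
  rw [sahiE_four_eq_of_pairwise_shrink (bernoulliWeight p) (ind D) (ind K) (ind X') (ind Y) (ind KD) (ind (KD \ D))
    (by rw [ind_diff_eq_sub hDKD]; ring) (by rw [mul_comm (ind K)]; exact aXK) (by rw [mul_comm (ind K)]; exact aYK) aXY]
  -- frame term: `(K_D, K, Y)` independent, `X'` free in slot 2
  have hU4 : ∀ j, IsUpperSet ((![KD, K, X', Y] : Fin 4 → Set (Set ι)) j) := by
    intro j; fin_cases j
    · exact hKD
    · exact hK
    · exact hX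
    · exact hY
  have t1 : 0 ≤ sahiE (bernoulliWeight p) 4 ![ind KD, ind K, ind X', ind Y] := by
    have h := sahiE_ind_nonneg_of_frame p ![KD, K, X', Y] hU4 2 (by
      intro j j' hj hj' hne
      fin_cases j <;> fin_cases j' <;>
        first
        | exact absurd rfl hne
        | exact absurd rfl hj
        | exact absurd rfl hj'
        | exact dKDK | exact dKDK.symm | exact dKDY | exact dKDY.symm | exact dKY | exact dKY.symm)
    have e1 : (fun j => ind ((![KD, K, X', Y] : Fin 4 → Set (Set ι)) j)) = ![ind KD, ind K, ind X', ind Y] := by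
      funext j; fin_cases j <;> rfl
    rwa [e1] at h
  have t2 := sahiE_two_vec_nonneg p hX hY
  have t3 := sahiE_two_vec_nonneg p hK hY
  have t4 := sahiE_two_vec_nonneg p hK hX
  have t5 : 0 ≤ sahiE (bernoulliWeight p) 3 ![ind K, ind X', ind Y] := by
    have hU3 : ∀ j, IsUpperSet ((![K, X', Y] : Fin 3 → Set (Set ι)) j) := by
      intro j; fin_cases j
      · exact hK
      · exact hX
      · exact hY
    have h := sahiE_three_ind_nonneg_of_indepPair p ![K, X', Y] hU3 1 (by
      have e : (fun j => (![K, X', Y] : Fin 3 → Set (Set ι)) ((1 : Fin 3).succAbove j)) = ![K, Y] := by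
        funext j; fin_cases j <;> rfl
      rw [e]; exact (suppZeroFlag_two_iff hK hY).2 dKY)
    have e : (fun j => ind ((![K, X', Y] : Fin 3 → Set (Set ι)) j)) = ![ind K, ind X', ind Y] := by
      funext j; fin_cases j <;> rfl
    rwa [e] at h
  have c1 := ex_ind_mul_nonneg p K (KD \ D)
  have c2 := ex_ind_mul_nonneg p X' (KD \ D)
  have c3 := ex_ind_mul_nonneg p Y (KD \ D)
  have c4 := ex_ind_nonneg' p (KD \ D)
  have := mul_nonneg c1 t2; have := mul_nonneg c2 t3; have := mul_nonneg c3 t4; have := mul_nonneg c4 t5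
  linarith

end Events

end Summit.CriticalPhenomena.PercolationContinuityZ3.Theorems
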